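import Summits.AtomisticToContinuum.HydrodynamicLimit.Theorems.CollisionIsometryCLTAdaptedWeightCLTBHEEPClosureDictionary

/-!
# Stub `stub_eepClosure` (S5) of the line `block-h-dissipation-closure`, helper file 6: UNIFORM BOUNDS for the
regularised law of a velocity cloud with a bounded sixth moment
(crux `CollisionIsometryCLT.AdaptedWeightCLT`, stmt-AtomisticToContinuum-14868; `--supports`)

The a-priori estimates that make every constant of steps (i)–(iii) of `stub_eepClosure` UNIFORM over the cells:
for a probability cloud `(p_i, v_i)` with `Σ p_i (1 + |v_i|²)³ ≤ R`, `0 < h < 1`, `0 < δ < 1`, and its regularised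
law `f̂ = cloudLaw h δ p v` with mean `ū`, floor `M = M_{1, θ̄ + h², ū}`:
* `|ū|² ≤ R`, `θ̄ ≤ 3R`, so the floor temperature lies in `[h², 3R + 1]` (`norm_cloudMean_sq_le`, `cloudTemp_le`);
* CO-MOVING LOG ENVELOPE (`exists_abs_log_cloudLaw_le`): there is `A = A(h, δ, R) ≥ 0` with
  `|log f̂(w)| ≤ A + |w − ū|²/(2h²)` and `|log M(w)| ≤ A + |w − ū|²/(2h²)` for all `w` (upper bound by the peak
  `(2πh²)^{-3/2}`, lower bound by `δ M` and the landed `EntropyBudget.log_lM_ge`);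
* SIXTH MOMENTS (`exists_integral_cloudLaw_mul_le`): there is `C = C(h, R)` with `∫ f̂ (1+|w|²)³ ≤ C` and
  `∫ M (1+|w|²)³ ≤ C` (transfer to the standard Gaussian, `(1 + |c + hz|²)³ ≤ 8 (1+|c|²)³ (1+|z|²)³`);
* integrability of `f̂ g` for continuous `g` of polynomial growth and of the relative-entropy integrand
  `f̂ log(f̂/M)` (`integrable_cloudLaw_mul_of_le`, `integrable_cloudLaw_mul_log_div`).
No definitions. Registered anchor: `bhEEPClosure_bounds_anchor` (the temperature bound, `∀`-closed, unfolded).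
-/

namespace Summit.AtomisticToContinuum.HydrodynamicLimit.Theorems.BlockHDissipation

open scoped BigOperators Topology Classical MeasureTheory ENNReal InnerProductSpace
open Filter Set MeasureTheory ProbabilityTheory Real
open Literature.Analysis.FluidPDE
open Summit.AtomisticToContinuum.HydrodynamicLimit.Theorems.ContactSourceDuhamel (T3 V3 Cfg Vel Flow Flows)
open Literature.MathematicalPhysics.KineticTheory (localMaxwellian_pos localMaxwellian_nonneg continuous_localMaxwellian
  integral_localMaxwellian_one integrable_localMaxwellian integral_localMaxwellian_smul)

noncomputable section

namespace EEP

open EntropyBudget (gauss_eq gauss_pos lM_le_gMax gMax_pos log_lM_ge log_lM_le')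
open DVTransfer (continuous_gauss)

variable {n : ℕ} {p : Fin n → ℝ} {v : Fin n → V3} {h δ R : ℝ}

/-! ## Consequences of the moment hypothesis `Σ p_i (1 + |v_i|²)³ ≤ R` -/

/-- `1 ≤ R`. -/
theorem one_le_of_moment (hp : ∀ i, 0 ≤ p i) (hp1 : ∑ i, p i = 1) (hR : ∑ i, p i * (1 + ‖v i‖ ^ 2) ^ 3 ≤ R) :
    1 ≤ R := by
  calc (1 : ℝ) = ∑ i, p i * 1 := by rw [← Finset.sum_mul, hp1, one_mul]
    _ ≤ ∑ i, p i * (1 + ‖v i‖ ^ 2) ^ 3 := Finset.sum_le_sum fun i _ =>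
        mul_le_mul_of_nonneg_left (one_le_pow₀ (by nlinarith [norm_nonneg (v i)])) (hp i)
    _ ≤ R := hR

/-- Second moments: `Σ p_i |v_i|² ≤ R`. -/
theorem sum_norm_sq_le_of_moment (hp : ∀ i, 0 ≤ p i) (hR : ∑ i, p i * (1 + ‖v i‖ ^ 2) ^ 3 ≤ R) :
    ∑ i, p i * ‖v i‖ ^ 2 ≤ R := by
  refine le_trans (Finset.sum_le_sum fun i _ => mul_le_mul_of_nonneg_left ?_ (hp i)) hR
  have h0 : 0 ≤ ‖v i‖ ^ 2 := sq_nonneg _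
  nlinarith [h0, sq_nonneg (‖v i‖ ^ 2)]

/-- `|ū|² ≤ R`. -/
theorem norm_cloudMean_sq_le (hp : ∀ i, 0 ≤ p i) (hp1 : ∑ i, p i = 1) (hR : ∑ i, p i * (1 + ‖v i‖ ^ 2) ^ 3 ≤ R) :
    ‖cloudMean p v‖ ^ 2 ≤ R :=
  (norm_cloudMean_pow_le hp hp1 2).trans (sum_norm_sq_le_of_moment hp hR)

/-- `θ̄ ≤ 3R`. -/
theorem cloudTemp_le (hp : ∀ i, 0 ≤ p i) (hp1 : ∑ i, p i = 1) (hR : ∑ i, p i * (1 + ‖v i‖ ^ 2) ^ 3 ≤ R) :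
    cloudTemp p v ≤ 3 * R := by
  have h := sum_norm_sub_mean_pow_le (v := v) hp hp1 2
  have h2 := sum_norm_sq_le_of_moment hp hR
  unfold cloudTemp
  rw [div_le_iff₀ (by norm_num : (0 : ℝ) < 3)]
  have h0 : 0 ≤ ∑ i, p i * ‖v i‖ ^ 2 := Finset.sum_nonneg fun i _ => mul_nonneg (hp i) (sq_nonneg _)
  calc ∑ i, p i * ‖v i - cloudMean p v‖ ^ 2 ≤ 2 ^ (2 + 1) * ∑ i, p i * ‖v i‖ ^ 2 := h
    _ ≤ 3 * R * 3 := by norm_num; nlinarith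

/-! ## The co-moving logarithmic envelope -/

/-- **LOG ENVELOPE**, explicit form: with `T = θ̄ + h² ∈ [h², Θ]`,
`|log f̂(w)| ≤ |log((2πh²)^{-3/2})| + |log δ| + (3/2)(|log(2πh²)| + |log(2πΘ)|) + |w − ū|²/(2h²)`. -/
theorem abs_log_cloudLaw_le {Θ : ℝ} (hp : ∀ i, 0 ≤ p i) (hp1 : ∑ i, p i = 1) (hh : 0 < h) (hδ : 0 < δ) (hδ1 : δ < 1)
    (hΘ : cloudTemp p v + h ^ 2 ≤ Θ) (w : V3) :
    |log (cloudLaw h δ p v w)| ≤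
      |log ((2 * Real.pi * h ^ 2) ^ (-(3 : ℝ) / 2))| + |log δ| +
        3 / 2 * (|log (2 * Real.pi * h ^ 2)| + |log (2 * Real.pi * Θ)|) + ‖w - cloudMean p v‖ ^ 2 / (2 * h ^ 2) := by
  set T := cloudTemp p v + h ^ 2 with hT
  have hT0 : h ^ 2 ≤ T := le_add_of_nonneg_left (cloudTemp_nonneg hp v)
  have hTpos : 0 < T := lt_of_lt_of_le (pow_pos hh 2) hT0
  have hfpos := cloudLaw_pos (v := v) hp hh hδ hδ1.le w
  -- upper bound
  have hup : log (cloudLaw h δ p v w) ≤ log ((2 * Real.pi * h ^ 2) ^ (-(3 : ℝ) / 2)) :=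
    Real.log_le_log hfpos (cloudLaw_le hp hp1 hh hδ.le hδ1.le w)
  -- lower bound through the floor
  have hlow : log δ + (-(3 / 2) * log (2 * Real.pi * T) - ‖w - cloudMean p v‖ ^ 2 / (2 * h ^ 2)) ≤
      log (cloudLaw h δ p v w) := by
    have h1 : log (δ * cloudMaxw h p v w) ≤ log (cloudLaw h δ p v w) :=
      Real.log_le_log (mul_pos hδ (cloudMaxw_pos hp hh w)) (delta_mul_cloudMaxw_le hp hh hδ1.le w)
    rw [Real.log_mul hδ.ne' (cloudMaxw_pos hp hh w).ne'] at h1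
    have h2 := log_lM_ge hh hT0 (cloudMean p v) w
    unfold cloudMaxw at h1
    linarith
  -- `|log(2πT)| ≤ |log(2πh²)| + |log(2πΘ)|` by monotonicity
  have hlogT : |log (2 * Real.pi * T)| ≤ |log (2 * Real.pi * h ^ 2)| + |log (2 * Real.pi * Θ)| := by
    have hl1 : log (2 * Real.pi * h ^ 2) ≤ log (2 * Real.pi * T) :=
      Real.log_le_log (by positivity) (mul_le_mul_of_nonneg_left hT0 (by positivity))
    have hl2 : log (2 * Real.pi * T) ≤ log (2 * Real.pi * Θ) :=
      Real.log_le_log (by positivity) (mul_le_mul_of_nonneg_left hΘ (by positivity))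
    rcases le_total 0 (log (2 * Real.pi * T)) with h0 | h0
    · rw [abs_of_nonneg h0]
      linarith [le_abs_self (log (2 * Real.pi * Θ)), abs_nonneg (log (2 * Real.pi * h ^ 2))]
    · rw [abs_of_nonpos h0]
      linarith [neg_abs_le (log (2 * Real.pi * h ^ 2)), abs_nonneg (log (2 * Real.pi * Θ))]
  rw [abs_le]
  constructor
  · linarith [hlow, neg_abs_le (log δ), hlogT, abs_nonneg (log ((2 * Real.pi * h ^ 2) ^ (-(3 : ℝ) / 2))),
      le_abs_self (log (2 * Real.pi * T))]
  · have hsq : 0 ≤ ‖w - cloudMean p v‖ ^ 2 / (2 * h ^ 2) := by positivity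
    linarith [hup, le_abs_self (log ((2 * Real.pi * h ^ 2) ^ (-(3 : ℝ) / 2))), abs_nonneg (log δ),
      abs_nonneg (log (2 * Real.pi * h ^ 2)), abs_nonneg (log (2 * Real.pi * Θ))]

/-- The same envelope for the floor: `|log M(w)| ≤ (same constant) + |w − ū|²/(2h²)`. -/
theorem abs_log_cloudMaxw_le {Θ : ℝ} (hp : ∀ i, 0 ≤ p i) (hh : 0 < h) (δ : ℝ)
    (hΘ : cloudTemp p v + h ^ 2 ≤ Θ) (w : V3) :
    |log (cloudMaxw h p v w)| ≤
      |log ((2 * Real.pi * h ^ 2) ^ (-(3 : ℝ) / 2))| + |log δ| +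
        3 / 2 * (|log (2 * Real.pi * h ^ 2)| + |log (2 * Real.pi * Θ)|) + ‖w - cloudMean p v‖ ^ 2 / (2 * h ^ 2) := by
  set T := cloudTemp p v + h ^ 2 with hT
  have hT0 : h ^ 2 ≤ T := le_add_of_nonneg_left (cloudTemp_nonneg hp v)
  have hTpos : 0 < T := lt_of_lt_of_le (pow_pos hh 2) hT0
  have hup : log (cloudMaxw h p v w) ≤ log ((2 * Real.pi * h ^ 2) ^ (-(3 : ℝ) / 2)) :=
    Real.log_le_log (cloudMaxw_pos hp hh w) (lM_le_gMax hh hT0 _ _)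
  have hlow := log_lM_ge hh hT0 (cloudMean p v) w
  have hlogT : |log (2 * Real.pi * T)| ≤ |log (2 * Real.pi * h ^ 2)| + |log (2 * Real.pi * Θ)| := by
    have hl1 : log (2 * Real.pi * h ^ 2) ≤ log (2 * Real.pi * T) :=
      Real.log_le_log (by positivity) (mul_le_mul_of_nonneg_left hT0 (by positivity))
    have hl2 : log (2 * Real.pi * T) ≤ log (2 * Real.pi * Θ) :=
      Real.log_le_log (by positivity) (mul_le_mul_of_nonneg_left hΘ (by positivity))
    rcases le_total 0 (log (2 * Real.pi * T)) with h0 | h0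
    · rw [abs_of_nonneg h0]
      linarith [le_abs_self (log (2 * Real.pi * Θ)), abs_nonneg (log (2 * Real.pi * h ^ 2))]
    · rw [abs_of_nonpos h0]
      linarith [neg_abs_le (log (2 * Real.pi * h ^ 2)), abs_nonneg (log (2 * Real.pi * Θ))]
  unfold cloudMaxw at hup hlow ⊢
  rw [abs_le]
  constructor
  · linarith [hlow, hlogT, abs_nonneg (log ((2 * Real.pi * h ^ 2) ^ (-(3 : ℝ) / 2))), abs_nonneg (log δ),
      le_abs_self (log (2 * Real.pi * T))]
  · have hsq : 0 ≤ ‖w - cloudMean p v‖ ^ 2 / (2 * h ^ 2) := by positivity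
    linarith [hup, le_abs_self (log ((2 * Real.pi * h ^ 2) ^ (-(3 : ℝ) / 2))), abs_nonneg (log δ),
      abs_nonneg (log (2 * Real.pi * h ^ 2)), abs_nonneg (log (2 * Real.pi * Θ))]

/-- **UNIFORM LOG ENVELOPE**: there is `A = A(h, δ, R) ≥ 0` such that every probability cloud with
`Σ p_i (1 + |v_i|²)³ ≤ R` has `|log f̂(w)| ≤ A + |w − ū|²/(2h²)` and `|log M(w)| ≤ A + |w − ū|²/(2h²)` (`h ≤ 1`). -/
theorem exists_abs_log_cloudLaw_le (hh : 0 < h) (hh1 : h ≤ 1) (hδ : 0 < δ) (hδ1 : δ < 1) (R : ℝ) :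
    ∃ A : ℝ, 0 ≤ A ∧ ∀ (n : ℕ) (p : Fin n → ℝ) (v : Fin n → V3), (∀ i, 0 ≤ p i) → ∑ i, p i = 1 →
      ∑ i, p i * (1 + ‖v i‖ ^ 2) ^ 3 ≤ R → ∀ w,
        |log (cloudLaw h δ p v w)| ≤ A + ‖w - cloudMean p v‖ ^ 2 / (2 * h ^ 2) ∧
        |log (cloudMaxw h p v w)| ≤ A + ‖w - cloudMean p v‖ ^ 2 / (2 * h ^ 2) := by
  refine ⟨|log ((2 * Real.pi * h ^ 2) ^ (-(3 : ℝ) / 2))| + |log δ| +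
      3 / 2 * (|log (2 * Real.pi * h ^ 2)| + |log (2 * Real.pi * (3 * R + 1))|), by positivity,
    fun n p v hp hp1 hR w => ?_⟩
  have hΘ : cloudTemp p v + h ^ 2 ≤ 3 * R + 1 := by
    have h1 := cloudTemp_le hp hp1 hR
    nlinarith
  exact ⟨abs_log_cloudLaw_le hp hp1 hh hδ hδ1 hΘ w, abs_log_cloudMaxw_le hp hh δ hΘ w⟩

/-! ## Sixth moments -/

/-- `1 + |c + h z|² ≤ 2 (1 + |c|²)(1 + |z|²)` for `|h| ≤ 1`… stated for `0 ≤ h ≤ 1`. -/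
theorem one_add_norm_sq_shift_le {h : ℝ} (hh : 0 ≤ h) (hh1 : h ≤ 1) (c z : V3) :
    1 + ‖c + h • z‖ ^ 2 ≤ 2 * (1 + ‖c‖ ^ 2) * (1 + ‖z‖ ^ 2) := by
  have h1 : ‖c + h • z‖ ≤ ‖c‖ + h * ‖z‖ := by
    refine (norm_add_le _ _).trans ?_
    rw [norm_smul, Real.norm_eq_abs, abs_of_nonneg hh]
  have h2 : ‖c + h • z‖ ^ 2 ≤ (‖c‖ + h * ‖z‖) ^ 2 := pow_le_pow_left₀ (norm_nonneg _) h1 2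
  have hz : h * ‖z‖ ≤ ‖z‖ := mul_le_of_le_one_left (norm_nonneg _) hh1
  nlinarith [norm_nonneg c, norm_nonneg z, mul_nonneg hh (norm_nonneg z), sq_nonneg (‖c‖ - h * ‖z‖),
    mul_nonneg (norm_nonneg c) (norm_nonneg z), sq_nonneg (‖c‖ * ‖z‖), sq_nonneg (h * ‖z‖ - ‖z‖)]

/-- `(1 + |z|²)³` is continuous. -/
theorem continuous_one_add_norm_sq_cube : Continuous fun z : V3 => (1 + ‖z‖ ^ 2) ^ 3 := by fun_prop

/-- `(1 + |z|²)³ ≤ (1 + |z|)⁶`. -/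
theorem one_add_norm_sq_cube_le (z : V3) : (1 + ‖z‖ ^ 2) ^ 3 ≤ (1 + ‖z‖) ^ 6 := by
  have : 1 + ‖z‖ ^ 2 ≤ (1 + ‖z‖) ^ 2 := by nlinarith [norm_nonneg z]
  calc (1 + ‖z‖ ^ 2) ^ 3 ≤ ((1 + ‖z‖) ^ 2) ^ 3 := pow_le_pow_left₀ (by positivity) this 3
    _ = (1 + ‖z‖) ^ 6 := by ring

/-- The sixth Gaussian moment weight is `γ`-integrable. -/
theorem integrable_one_add_norm_sq_cube : Integrable (fun z : V3 => (1 + ‖z‖ ^ 2) ^ 3) (stdGaussian V3) :=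
  integrable_gamma_of_le continuous_one_add_norm_sq_cube (C := 1) (k := 6) fun z => by
    rw [abs_of_nonneg (by positivity), one_mul]; exact one_add_norm_sq_cube_le z

/-- **Sixth moment of the mollifier**: `∫ G_h(w − c) (1+|w|²)³ dw ≤ 8 (1+|c|²)³ K₆`, `K₆ = ∫ (1+|z|²)³ dγ`. -/
theorem integral_gauss_mul_cube_le (hh : 0 < h) (hh1 : h ≤ 1) (c : V3) :
    ∫ w, gauss h c w * (1 + ‖w‖ ^ 2) ^ 3 ≤
      8 * (1 + ‖c‖ ^ 2) ^ 3 * ∫ z, (1 + ‖z‖ ^ 2) ^ 3 ∂stdGaussian V3 := by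
  rw [integral_gauss_mul hh c (fun w => (1 + ‖w‖ ^ 2) ^ 3), ← integral_const_mul]
  refine integral_mono_of_nonneg (Eventually.of_forall fun z => by positivity)
    (integrable_one_add_norm_sq_cube.const_mul _) (Eventually.of_forall fun z => ?_)
  have h1 := one_add_norm_sq_shift_le hh.le hh1 c z
  calc (1 + ‖c + h • z‖ ^ 2) ^ 3 ≤ (2 * (1 + ‖c‖ ^ 2) * (1 + ‖z‖ ^ 2)) ^ 3 := pow_le_pow_left₀ (by positivity) h1 3
    _ = 8 * (1 + ‖c‖ ^ 2) ^ 3 * (1 + ‖z‖ ^ 2) ^ 3 := by ring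

/-- **Sixth moment of a Maxwellian**: `∫ M_{1,θ,u} (1+|w|²)³ ≤ 8 (1+|u|²)³ (1+θ)³ K₆` (`θ > 0`). -/
theorem integral_localMaxwellian_mul_cube_le {θ : ℝ} (hθ : 0 < θ) (u : V3) :
    ∫ w, localMaxwellian 1 θ u w * (1 + ‖w‖ ^ 2) ^ 3 ≤
      8 * (1 + ‖u‖ ^ 2) ^ 3 * (1 + θ) ^ 3 * ∫ z, (1 + ‖z‖ ^ 2) ^ 3 ∂stdGaussian V3 := by
  have ht := integral_localMaxwellian_smul (F := ℝ) hθ u (fun w => (1 + ‖w‖ ^ 2) ^ 3)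
  simp only [smul_eq_mul] at ht
  rw [ht, ← integral_const_mul]
  refine integral_mono_of_nonneg (Eventually.of_forall fun z => by positivity)
    (integrable_one_add_norm_sq_cube.const_mul _) (Eventually.of_forall fun z => ?_)
  -- `1 + |u + √θ z|² ≤ 2 (1+|u|²)(1 + θ|z|²) ≤ 2 (1+|u|²)(1+θ)(1+|z|²)`
  have h1 : ‖u + Real.sqrt θ • z‖ ^ 2 ≤ 2 * ‖u‖ ^ 2 + 2 * (θ * ‖z‖ ^ 2) := by
    have hn : ‖u + Real.sqrt θ • z‖ ≤ ‖u‖ + Real.sqrt θ * ‖z‖ := by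
      refine (norm_add_le _ _).trans ?_
      rw [norm_smul, Real.norm_eq_abs, abs_of_nonneg (Real.sqrt_nonneg θ)]
    have hs : (Real.sqrt θ * ‖z‖) ^ 2 = θ * ‖z‖ ^ 2 := by rw [mul_pow, Real.sq_sqrt hθ.le]
    nlinarith [sq_nonneg (‖u‖ - Real.sqrt θ * ‖z‖), norm_nonneg (u + Real.sqrt θ • z), norm_nonneg u,
      mul_nonneg (Real.sqrt_nonneg θ) (norm_nonneg z)]
  have h2 : 1 + ‖u + Real.sqrt θ • z‖ ^ 2 ≤ 2 * (1 + ‖u‖ ^ 2) * (1 + θ) * (1 + ‖z‖ ^ 2) := by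
    nlinarith [h1, sq_nonneg ‖u‖, sq_nonneg ‖z‖, hθ.le, mul_nonneg hθ.le (sq_nonneg ‖z‖),
      mul_nonneg (sq_nonneg ‖u‖) (sq_nonneg ‖z‖), mul_nonneg (mul_nonneg hθ.le (sq_nonneg ‖u‖)) (sq_nonneg ‖z‖),
      mul_nonneg hθ.le (sq_nonneg ‖u‖)]
  calc (1 + ‖u + Real.sqrt θ • z‖ ^ 2) ^ 3 ≤ (2 * (1 + ‖u‖ ^ 2) * (1 + θ) * (1 + ‖z‖ ^ 2)) ^ 3 :=
        pow_le_pow_left₀ (by positivity) h2 3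
    _ = 8 * (1 + ‖u‖ ^ 2) ^ 3 * (1 + θ) ^ 3 * (1 + ‖z‖ ^ 2) ^ 3 := by ring

/-- Integrability of `f̂ g` for a continuous `g` of polynomial growth. -/
theorem integrable_cloudLaw_mul_of_le (hp : ∀ i, 0 ≤ p i) (hh : 0 < h) (δ : ℝ) {g : V3 → ℝ} (hg : Continuous g)
    {C : ℝ} {k : ℕ} (hle : ∀ w, |g w| ≤ C * (1 + ‖w‖) ^ k) :
    Integrable (fun w => cloudLaw h δ p v w * g w) := by
  have hterm := fun i => integrable_cloudKde_term (p := p) (v := v) hh i hg hle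
  have hM := integrable_cloudMaxw_mul (p := p) (v := v) hp hh hg hle
  have hsplit : (fun w => cloudLaw h δ p v w * g w) =
      fun w => (1 - δ) * (∑ i, p i * gauss h (v i) w * g w) + δ * (cloudMaxw h p v w * g w) := by
    funext w; unfold cloudLaw cloudKde; rw [← Finset.sum_mul]; ring
  rw [hsplit]
  exact ((integrable_finsetSum _ fun i _ => hterm i).const_mul _).fun_add (hM.const_mul _)

/-- **UNIFORM SIXTH MOMENTS**: there is `C = C(R) ≥ 0` such that for every `0 < h ≤ 1`, `0 ≤ δ ≤ 1` and every
probability cloud with `Σ p_i (1 + |v_i|²)³ ≤ R`: `∫ f̂ (1+|w|²)³ ≤ C` and `∫ M (1+|w|²)³ ≤ C`. -/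
theorem exists_integral_cloudLaw_mul_cube_le (R : ℝ) :
    ∃ C : ℝ, 0 ≤ C ∧ ∀ (h δ : ℝ), 0 < h → h ≤ 1 → 0 ≤ δ → δ ≤ 1 →
      ∀ (n : ℕ) (p : Fin n → ℝ) (v : Fin n → V3), (∀ i, 0 ≤ p i) → ∑ i, p i = 1 →
        ∑ i, p i * (1 + ‖v i‖ ^ 2) ^ 3 ≤ R →
          ∫ w, cloudLaw h δ p v w * (1 + ‖w‖ ^ 2) ^ 3 ≤ C ∧ ∫ w, cloudMaxw h p v w * (1 + ‖w‖ ^ 2) ^ 3 ≤ C := by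
  set K : ℝ := ∫ z, (1 + ‖z‖ ^ 2) ^ 3 ∂stdGaussian V3 with hK
  have hK0 : 0 ≤ K := integral_nonneg fun z => by positivity
  refine ⟨8 * |R| * K + 8 * (1 + |R|) ^ 3 * (2 + 3 * |R|) ^ 3 * K, by positivity,
    fun h δ hh hh1 hδ hδ1 n p v hp hp1 hR => ?_⟩
  have hR1 := one_le_of_moment hp hp1 hR
  have hRabs : |R| = R := abs_of_nonneg (by linarith)
  rw [hRabs]
  have hT0 : 0 < cloudTemp p v + h ^ 2 := cloudTemp_add_sq_pos hp v hh
  have hTle : cloudTemp p v + h ^ 2 ≤ 1 + 3 * R := by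
    have := cloudTemp_le hp hp1 hR; nlinarith
  have hu : ‖cloudMean p v‖ ^ 2 ≤ R := norm_cloudMean_sq_le hp hp1 hR
  -- the floor
  have hMle : ∫ w, cloudMaxw h p v w * (1 + ‖w‖ ^ 2) ^ 3 ≤ 8 * (1 + R) ^ 3 * (2 + 3 * R) ^ 3 * K := by
    refine (integral_localMaxwellian_mul_cube_le hT0 (cloudMean p v)).trans ?_
    have h1 : (1 + ‖cloudMean p v‖ ^ 2) ^ 3 ≤ (1 + R) ^ 3 := pow_le_pow_left₀ (by positivity) (by linarith) 3
    have h2 : (1 + (cloudTemp p v + h ^ 2)) ^ 3 ≤ (2 + 3 * R) ^ 3 := pow_le_pow_left₀ (by positivity) (by linarith) 3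
    have := mul_le_mul h1 h2 (by positivity) (by positivity)
    nlinarith [this, hK0]
  -- the mollified atoms
  have hGle : ∀ i, ∫ w, gauss h (v i) w * (1 + ‖w‖ ^ 2) ^ 3 ≤ 8 * (1 + ‖v i‖ ^ 2) ^ 3 * K := fun i =>
    integral_gauss_mul_cube_le hh hh1 (v i)
  have hsum : ∑ i, p i * ∫ w, gauss h (v i) w * (1 + ‖w‖ ^ 2) ^ 3 ≤ 8 * R * K := by
    calc ∑ i, p i * ∫ w, gauss h (v i) w * (1 + ‖w‖ ^ 2) ^ 3 ≤ ∑ i, p i * (8 * (1 + ‖v i‖ ^ 2) ^ 3 * K) :=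
          Finset.sum_le_sum fun i _ => mul_le_mul_of_nonneg_left (hGle i) (hp i)
      _ = 8 * K * ∑ i, p i * (1 + ‖v i‖ ^ 2) ^ 3 := by rw [Finset.mul_sum]; exact Finset.sum_congr rfl fun i _ => by ring
      _ ≤ 8 * K * R := mul_le_mul_of_nonneg_left hR (by positivity)
      _ = 8 * R * K := by ring
  refine ⟨?_, hMle.trans (le_add_of_nonneg_left (by positivity))⟩
  rw [integral_cloudLaw_mul hp hh continuous_one_add_norm_sq_cube (C := 1) (k := 6)
    (fun w => by rw [abs_of_nonneg (by positivity), one_mul]; exact one_add_norm_sq_cube_le w)]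
  have h1δ : 0 ≤ 1 - δ := sub_nonneg.2 hδ1
  calc (1 - δ) * (∑ i, p i * ∫ w, gauss h (v i) w * (1 + ‖w‖ ^ 2) ^ 3) +
        δ * ∫ w, cloudMaxw h p v w * (1 + ‖w‖ ^ 2) ^ 3
      ≤ (1 - δ) * (8 * R * K) + δ * (8 * (1 + R) ^ 3 * (2 + 3 * R) ^ 3 * K) :=
        add_le_add (mul_le_mul_of_nonneg_left hsum h1δ) (mul_le_mul_of_nonneg_left hMle hδ)
    _ ≤ 8 * R * K + 8 * (1 + R) ^ 3 * (2 + 3 * R) ^ 3 * K := by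
        nlinarith [mul_nonneg hδ (by positivity : (0 : ℝ) ≤ 8 * R * K),
          mul_nonneg h1δ (by positivity : (0 : ℝ) ≤ 8 * (1 + R) ^ 3 * (2 + 3 * R) ^ 3 * K)]

/-- Integrability of the relative-entropy integrand `f̂ log(f̂/M)` (continuous integrand of quadratic growth). -/
theorem integrable_cloudLaw_mul_log_div (hp : ∀ i, 0 ≤ p i) (hp1 : ∑ i, p i = 1) (hh : 0 < h) (hh1 : h ≤ 1)
    (hδ : 0 < δ) (hδ1 : δ < 1) {R : ℝ} (hR : ∑ i, p i * (1 + ‖v i‖ ^ 2) ^ 3 ≤ R) :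
    Integrable (fun w => cloudLaw h δ p v w * log (cloudLaw h δ p v w / cloudMaxw h p v w)) := by
  obtain ⟨A, hA0, hA⟩ := exists_abs_log_cloudLaw_le hh hh1 hδ hδ1 R
  have hcont : Continuous fun w => log (cloudLaw h δ p v w / cloudMaxw h p v w) := by
    have h1 : Continuous (cloudLaw h δ p v) := continuous_cloudLaw h δ p v
    have h2 : Continuous (cloudMaxw h p v) := continuous_localMaxwellian _ _ _
    exact (h1.div h2 fun w => (cloudMaxw_pos hp hh w).ne').log fun w =>
      (div_pos (cloudLaw_pos hp hh hδ hδ1.le w) (cloudMaxw_pos hp hh w)).ne'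
  refine integrable_cloudLaw_mul_of_le hp hh δ hcont (C := 2 * A + (1 + ‖cloudMean p v‖) ^ 2 / h ^ 2) (k := 2)
    fun w => ?_
  obtain ⟨hf, hM⟩ := hA n p v hp hp1 hR w
  rw [Real.log_div (cloudLaw_pos hp hh hδ hδ1.le w).ne' (cloudMaxw_pos hp hh w).ne']
  have hsub : ‖w - cloudMean p v‖ ≤ (1 + ‖cloudMean p v‖) * (1 + ‖w‖) := by
    have := norm_sub_le w (cloudMean p v)
    nlinarith [norm_nonneg w, norm_nonneg (cloudMean p v), mul_nonneg (norm_nonneg w) (norm_nonneg (cloudMean p v))]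
  have hsq : ‖w - cloudMean p v‖ ^ 2 ≤ (1 + ‖cloudMean p v‖) ^ 2 * (1 + ‖w‖) ^ 2 := by
    rw [← mul_pow]; exact pow_le_pow_left₀ (norm_nonneg _) hsub 2
  have h1w : 1 ≤ (1 + ‖w‖) ^ 2 := one_le_pow₀ (by linarith [norm_nonneg w])
  calc |log (cloudLaw h δ p v w) - log (cloudMaxw h p v w)|
      ≤ |log (cloudLaw h δ p v w)| + |log (cloudMaxw h p v w)| := abs_sub _ _
    _ ≤ 2 * A + ‖w - cloudMean p v‖ ^ 2 / h ^ 2 := by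
        have : ‖w - cloudMean p v‖ ^ 2 / (2 * h ^ 2) + ‖w - cloudMean p v‖ ^ 2 / (2 * h ^ 2) =
            ‖w - cloudMean p v‖ ^ 2 / h ^ 2 := by field_simp; ring
        linarith
    _ ≤ 2 * A * (1 + ‖w‖) ^ 2 + (1 + ‖cloudMean p v‖) ^ 2 / h ^ 2 * (1 + ‖w‖) ^ 2 := by
        have h1 : 2 * A ≤ 2 * A * (1 + ‖w‖) ^ 2 := le_mul_of_one_le_right (by positivity) h1w
        have h2 : ‖w - cloudMean p v‖ ^ 2 / h ^ 2 ≤ (1 + ‖cloudMean p v‖) ^ 2 / h ^ 2 * (1 + ‖w‖) ^ 2 := by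
          rw [div_mul_eq_mul_div]; exact div_le_div_of_nonneg_right hsq (by positivity)
        linarith
    _ = (2 * A + (1 + ‖cloudMean p v‖) ^ 2 / h ^ 2) * (1 + ‖w‖) ^ 2 := by ring

end EEP

/-- Registered anchor of this helper file: the temperature of a probability cloud with `Σ p_i (1 + |v_i|²)³ ≤ R` is at
most `3R` (`EEP.cloudTemp_le`, unfolded). -/
theorem bhEEPClosure_bounds_anchor : ∀ (n : ℕ) (p : Fin n → ℝ) (v : Fin n → V3) (R : ℝ), (∀ i, 0 ≤ p i) → ∑ i, p i = 1 → ∑ i, p i * (1 + ‖v i‖ ^ 2) ^ 3 ≤ R → (∑ i, p i * ‖v i - ∑ l, p l • v l‖ ^ 2) / 3 ≤ 3 * R :=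
  fun _ _ _ _ hp hp1 hR => EEP.cloudTemp_le hp hp1 hR

end

end Summit.AtomisticToContinuum.HydrodynamicLimit.Theorems.BlockHDissipation
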